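import Literature.MathematicalPhysics.QuantumFieldTheory.Balaban1983to89.B9Eq340TaxiForward

/-!
# `Balaban1983to89.B9Thm31SiteCoerciveTaxiBlockY` — T. Bałaban, *Propagators for lattice gauge theories in a background field*, Commun. Math.
# Phys. **99** (1985) 389–434 [Balaban1985BackgroundPropagators] (3.3) p. 391, (3.19) p. 393, (3.40) p. 397 with (3.35) p. 396: def-Y's TAXICAB
# CONTOUR VARIABLE `U(Γ_{x₀,x})` TOWARDS A POINT AHEAD OF `x₀` BY LESS THAN HALF A PERIOD runs FORWARD INSIDE THE COORDINATE BOX `[x₀, x]`, so it is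
# `(Σ_μ δ_μ)·ρ`-close to `1` whenever the bond variables with source in that box are `ρ`-close to `1` (file 2b of the site-operator coercivity set)

statement-level skeleton of published theorems with citation tags; proofs where landed; nothing here is a claim about the Yang–Mills mass gap

THE PRINT (verbatim).  (3.19) p. 393: *«(Q′_j(U)λ)(y) = Σ_{x∈B^j(y)} L^{−jd} R(U(Γ^j_{y,x}))λ(x)»* — the block average transports every site of the
block to the block's reference point along a contour INSIDE the block; (3.40) p. 397: *«Γ_{x,x′} is a shortest contour connecting points x and x′»*;
(3.35) p. 396: *«U^u = e^{iηA} … |A| < O(1)Mα₀(Lʲη)⁻¹ on □»* — in the cube gauge every bond variable with source in the cube is `O(Mα₀L^{−j})`-close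
to `1`, hence so is (up to the number of bonds) every contour variable of a contour inside the cube.

WHY THIS FILE (cell `pub-ymgap`, Track A node N06 [B9], width seat `pub-ymgap-dag-n06-w1`, OFFER-A).  File 2 (`B9Thm31SiteCoerciveGaugeBlockY`) bounds a
block's share of (3.24)'s form at def-Y's letters from below in terms of TWO smallness letters of a gauge: `ρ` (gauged bond variables on the block) and
`ρ′` (gauged block transporters `U^u(Γ_{c,z})`, `c` the block corner).  THIS FILE derives the second from the first for def-Y's taxicab transporter
`Node00.parTaxiV` (the torus-level letter under `parSY ∕ parSymY`): from the block corner `x₀` to a block point `x` every leg of the taxicab contour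
takes the FORWARD branch (the target is ahead by `δ_μ < L^j ≤ N∕2` in every coordinate), the sources of its bonds lie in the coordinate box
`{y : (y_ν − x₀,ν) mod N ≤ δ_ν ∀ν}` with `(y_μ − x₀,μ) mod N < δ_μ` in the leg's direction, and a product of `n` contraction units each `ρ`-close to `1`
is `nρ`-close to `1`.  File 3 reads the box condition on NODE 00's box chart (the box IS inside the block) and feeds file 2.
PRIOR ART DECLARED: the contour bookkeeping `taxiLegV_fst_apply ∕ taxiRun_fst_apply ∕ iterate_shift_apply` is def-Y's (`Node00.OpsYTransport`) and the
forward branch `taxiLegV_of_fwd` ∕ the forward-regime reading is dag-n06-i's (`B9Eq340TaxiForward`, whose lasso bounds concern a different quantity), used BY NAME; pub-balaban's NE9 chain bounds ITS axial-gauge transporters on `TSite` carriers (`B9Thm311SitePrimeFormCoercivePlaquette` §1) — nothing restated.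

WHAT IS PROVED (sorry-free; 0 `def`; [folklore] normed-ring bookkeeping + an induction along def-Y's contour construction; nothing of [B9] asserted).
* §1 units near `1`: private `norm_mul_sub_one_le` (`|ab − 1| ≤ |a − 1| + |b − 1|` for `|a| ≤ 1`), ★ `parFwdV_near_one` (the forward segment variable of `n` bonds,
  each `ρ`-close to `1` and a contraction pair, is `nρ`-close to `1` and a contraction pair).
* §2 the forward box run (the forward branch of a leg is dag-n06-i's `B9Eq340TaxiForward.taxiLegV_of_fwd`, BY NAME): private `val_natCast_of_lt` ∕ `val_add_natCast_sub` ∕ `fwd_of_half`, ★★ `taxiRun_near_one_of_box` (invariant induction over the legs),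
  ★★★ `parTaxiV_near_one_of_box`: if `2δ_μ ≤ N` and `δ_μ ≤ m` for all `μ` (`δ_μ = (x_μ − x₀,μ) mod N`) and every bond `⟨y, y + e_μ⟩` with `y` in the box
  and `(y_μ − x₀,μ) mod N < δ_μ` is `ρ`-close to `1` and a contraction pair, then `|U(Γ_{x₀,x}) − 1| ≤ d·m·ρ` and `U(Γ_{x₀,x})` is a contraction pair
  (`d` = number of directions).
HONEST SCOPE.  Elementary; (3.35) is NOT unpacked here (file 3); NOT a node discharge, NOT summit progress; count-neutral; one finite lattice at a time;
nothing continuum ∕ OS ∕ mass gap ∕ Clay.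
-/

namespace Literature.MathematicalPhysics.QuantumFieldTheory.Balaban1983to89.B9Thm31SiteCoerciveTaxiBlockY

open Literature.MathematicalPhysics.QuantumFieldTheory.Balaban1983to89
open Node00 B9BackgroundsKLevelV1

noncomputable section

/-! ## §1 Products of contraction units near `1` -/

section Units

variable {𝔸 : Type} [NormedRing 𝔸]

/-- `|ab − 1| ≤ |a − 1| + |b − 1|` for `|a| ≤ 1` (`ab − 1 = a(b − 1) + (a − 1)`). [folklore] -/
private theorem norm_mul_sub_one_le {a b : 𝔸} (ha : ‖a‖ ≤ 1) : ‖a * b - 1‖ ≤ ‖a - 1‖ + ‖b - 1‖ := by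
  have e : a * b - 1 = a * (b - 1) + (a - 1) := by noncomm_ring
  rw [e]
  calc ‖a * (b - 1) + (a - 1)‖ ≤ ‖a * (b - 1)‖ + ‖a - 1‖ := norm_add_le _ _
    _ ≤ ‖a‖ * ‖b - 1‖ + ‖a - 1‖ := by gcongr; exact norm_mul_le _ _
    _ ≤ 1 * ‖b - 1‖ + ‖a - 1‖ := by gcongr
    _ = ‖a - 1‖ + ‖b - 1‖ := by ring

variable {P : Params} (h1 : ‖(1 : 𝔸)‖ ≤ 1)
include h1

/-- ★ THE FORWARD SEGMENT VARIABLE `U_μ(y)U_μ(y+e_μ)⋯U_μ(y+(n−1)e_μ)`: if each of its `n` bond variables is `ρ`-close to `1` and a contraction pair, the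
segment variable is `nρ`-close to `1` and a contraction pair. [cite: Balaban1985BackgroundPropagators, (3.3) p.391, (3.35) p.396, bookkeeping] -/
theorem parFwdV_near_one {V : CfgV1 P 𝔸} {μ : Fin P.d} {ρ : ℝ} :
    ∀ (n : ℕ) (y : Site P 0),
      (∀ t < n, ‖(V μ ((fun w : Site P 0 => w.shift μ)^[t] y) : 𝔸) - 1‖ ≤ ρ ∧ ‖(V μ ((fun w : Site P 0 => w.shift μ)^[t] y) : 𝔸)‖ ≤ 1 ∧
        ‖(((V μ ((fun w : Site P 0 => w.shift μ)^[t] y))⁻¹ : 𝔸ˣ) : 𝔸)‖ ≤ 1) →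
      ‖(parFwdV V μ n y : 𝔸) - 1‖ ≤ n * ρ ∧ ‖(parFwdV V μ n y : 𝔸)‖ ≤ 1 ∧ ‖(((parFwdV V μ n y)⁻¹ : 𝔸ˣ) : 𝔸)‖ ≤ 1
  | 0, y, _ => by
    refine ⟨?_, ?_, ?_⟩
    · simp
    · simpa using h1
    · simpa using h1
  | n + 1, y, h => by
    have h0 := h 0 (Nat.succ_pos n)
    simp only [Function.iterate_zero, id_eq] at h0
    have htail : ∀ t < n, ‖(V μ ((fun w : Site P 0 => w.shift μ)^[t] (y.shift μ)) : 𝔸) - 1‖ ≤ ρ ∧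
        ‖(V μ ((fun w : Site P 0 => w.shift μ)^[t] (y.shift μ)) : 𝔸)‖ ≤ 1 ∧
        ‖(((V μ ((fun w : Site P 0 => w.shift μ)^[t] (y.shift μ)))⁻¹ : 𝔸ˣ) : 𝔸)‖ ≤ 1 := by
      intro t ht
      have := h (t + 1) (by omega)
      rwa [Function.iterate_succ_apply] at this
    obtain ⟨ih1, ih2, ih3⟩ := parFwdV_near_one n (y.shift μ) htail
    have hρ : 0 ≤ ρ := le_trans (norm_nonneg _) h0.1
    rw [parFwdV_succ]
    refine ⟨?_, ?_, ?_⟩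
    · rw [Units.val_mul]
      calc ‖(V μ y : 𝔸) * (parFwdV V μ n (y.shift μ) : 𝔸) - 1‖
          ≤ ‖(V μ y : 𝔸) - 1‖ + ‖(parFwdV V μ n (y.shift μ) : 𝔸) - 1‖ := norm_mul_sub_one_le h0.2.1
        _ ≤ ρ + n * ρ := add_le_add h0.1 ih1
        _ = ((n + 1 : ℕ) : ℝ) * ρ := by push_cast; ring
    · rw [Units.val_mul]
      calc ‖(V μ y : 𝔸) * (parFwdV V μ n (y.shift μ) : 𝔸)‖ ≤ ‖(V μ y : 𝔸)‖ * ‖(parFwdV V μ n (y.shift μ) : 𝔸)‖ := norm_mul_le _ _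
        _ ≤ 1 * 1 := mul_le_mul h0.2.1 ih2 (norm_nonneg _) zero_le_one
        _ = 1 := mul_one 1
    · rw [mul_inv_rev, Units.val_mul]
      calc ‖(((parFwdV V μ n (y.shift μ))⁻¹ : 𝔸ˣ) : 𝔸) * (((V μ y)⁻¹ : 𝔸ˣ) : 𝔸)‖
          ≤ ‖(((parFwdV V μ n (y.shift μ))⁻¹ : 𝔸ˣ) : 𝔸)‖ * ‖(((V μ y)⁻¹ : 𝔸ˣ) : 𝔸)‖ := norm_mul_le _ _
        _ ≤ 1 * 1 := mul_le_mul ih3 h0.2.2 (norm_nonneg _) zero_le_one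
        _ = 1 := mul_one 1

end Units

/-! ## §2 The forward box run of the taxicab contour -/

section Box

variable {P : Params} {𝔸 : Type} [NormedRing 𝔸]

/-- a natural number below the period is its own residue. [folklore] -/
private theorem val_natCast_of_lt {t : ℕ} (ht : t < P.sitesPerDir 0) : ((t : ZMod (P.sitesPerDir 0))).val = t := by
  rw [ZMod.val_natCast, Nat.mod_eq_of_lt ht]

/-- `((a + t) − a) mod N = t` for `t < N`. [folklore] -/
private theorem val_add_natCast_sub {a : ZMod (P.sitesPerDir 0)} {t : ℕ} (ht : t < P.sitesPerDir 0) : (a + (t : ZMod (P.sitesPerDir 0)) - a).val = t := by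
  rw [add_sub_cancel_left, val_natCast_of_lt ht]

/-- the forward branch is taken when the target is ahead by at most half a period. [folklore] -/
private theorem fwd_of_half {a b : ZMod (P.sitesPerDir 0)} (h : 2 * (b - a).val ≤ P.sitesPerDir 0) : (b - a).val ≤ (a - b).val := by
  by_cases hab : b - a = 0
  · have : a - b = 0 := by rw [← neg_sub, hab, neg_zero]
    rw [hab, this]
  · haveI : NeZero (b - a) := ⟨hab⟩
    have hneg : a - b = -(b - a) := (neg_sub b a).symm
    rw [hneg, ZMod.val_neg_of_ne_zero (b - a)]
    have := ZMod.val_lt (b - a)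
    omega

variable (h1 : ‖(1 : 𝔸)‖ ≤ 1)
include h1

/-- ★★ THE FORWARD BOX RUN (induction over the legs): from a state whose point `p` lies in the box of `(x₀, x)` (`(p_ν − x₀,ν) mod N ≤ δ_ν` for all `ν`)
and agrees with `x₀` on the remaining directions `l` (no repeats), running the legs `l` towards `x` multiplies the accumulated transporter by contour
variables whose bonds have sources in the box, strictly behind `x` in their own direction; if those bond variables are `ρ`-close to `1` and contraction
pairs, the accumulated defect grows by at most `|l|·m·ρ` (`δ_μ ≤ m`). [cite: Balaban1985BackgroundPropagators, (3.19) p.393, (3.40) p.397, (3.35) p.396] -/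
theorem taxiRun_near_one_of_box {V : CfgV1 P 𝔸} {x₀ x : Site P 0} {ρ : ℝ} {m : ℕ} (hρ : 0 ≤ ρ)
    (hhalf : ∀ μ, 2 * (x μ - x₀ μ).val ≤ P.sitesPerDir 0) (hm : ∀ μ, (x μ - x₀ μ).val ≤ m)
    (hbond : ∀ (μ : Fin P.d) (y : Site P 0), (∀ ν, (y ν - x₀ ν).val ≤ (x ν - x₀ ν).val) → (y μ - x₀ μ).val < (x μ - x₀ μ).val →
      ‖(V μ y : 𝔸) - 1‖ ≤ ρ ∧ ‖(V μ y : 𝔸)‖ ≤ 1 ∧ ‖(((V μ y)⁻¹ : 𝔸ˣ) : 𝔸)‖ ≤ 1) :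
    ∀ (l : List (Fin P.d)) (s : Site P 0 × 𝔸ˣ) (A : ℝ), l.Nodup → (∀ ν ∈ l, s.1 ν = x₀ ν) → (∀ ν, (s.1 ν - x₀ ν).val ≤ (x ν - x₀ ν).val) →
      ‖(s.2 : 𝔸) - 1‖ ≤ A → ‖(s.2 : 𝔸)‖ ≤ 1 → ‖((s.2⁻¹ : 𝔸ˣ) : 𝔸)‖ ≤ 1 →
      ‖((taxiRun V x l s).2 : 𝔸) - 1‖ ≤ A + l.length * (m * ρ) ∧ ‖((taxiRun V x l s).2 : 𝔸)‖ ≤ 1 ∧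
        ‖((((taxiRun V x l s).2)⁻¹ : 𝔸ˣ) : 𝔸)‖ ≤ 1
  | [], s, A, _, _, _, hA, hs1, hs2 => by
    simp only [taxiRun, List.foldl_nil, List.length_nil, Nat.cast_zero, zero_mul, add_zero]
    exact ⟨hA, hs1, hs2⟩
  | μ :: l, s, A, hnd, hstart, hbox, hA, hs1, hs2 => by
    have hμ : s.1 μ = x₀ μ := hstart μ (by simp)
    have hnd' : l.Nodup := (List.nodup_cons.1 hnd).2
    have hμl : μ ∉ l := (List.nodup_cons.1 hnd).1
    -- the leg `μ` runs forward by `δ_μ` steps from `s.1`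
    have hδ : (x μ - s.1 μ).val = (x μ - x₀ μ).val := by rw [hμ]
    have hfwd : (x μ - s.1 μ).val ≤ (s.1 μ - x μ).val := by rw [hμ]; exact fwd_of_half (hhalf μ)
    have hleg := B9Eq340TaxiForward.taxiLegV_of_fwd V x s μ hfwd
    -- the bonds of the leg
    have hN2 : ∀ t < (x μ - x₀ μ).val, t < P.sitesPerDir 0 := fun t ht => by
      have := hhalf μ; have := ZMod.val_lt (x μ - x₀ μ); omega
    have hsrc : ∀ t < (x μ - x₀ μ).val,
        ‖(V μ ((fun w : Site P 0 => w.shift μ)^[t] s.1) : 𝔸) - 1‖ ≤ ρ ∧ ‖(V μ ((fun w : Site P 0 => w.shift μ)^[t] s.1) : 𝔸)‖ ≤ 1 ∧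
          ‖(((V μ ((fun w : Site P 0 => w.shift μ)^[t] s.1))⁻¹ : 𝔸ˣ) : 𝔸)‖ ≤ 1 := by
      intro t ht
      refine hbond μ _ (fun ν => ?_) ?_
      · rw [iterate_shift_apply]
        by_cases hν : ν = μ
        · subst hν; rw [if_pos rfl, hμ, val_add_natCast_sub (hN2 t ht)]; exact ht.le
        · rw [if_neg hν]; exact hbox ν
      · rw [iterate_shift_apply, if_pos rfl, hμ, val_add_natCast_sub (hN2 t ht)]; exact ht
    obtain ⟨hF1, hF2, hF3⟩ := parFwdV_near_one h1 (x μ - x₀ μ).val s.1 (by rw [← hδ] at hsrc ⊢; exact hsrc)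
    -- the state after the leg
    set s' := taxiLegV V x s μ with hs'
    have hs'2 : s'.2 = s.2 * parFwdV V μ (x μ - s.1 μ).val s.1 := by rw [hleg]
    have hstart' : ∀ ν ∈ l, s'.1 ν = x₀ ν := by
      intro ν hν
      have hne : ν ≠ μ := fun h => hμl (h ▸ hν)
      rw [hs', taxiLegV_fst_apply, if_neg hne]
      exact hstart ν (List.mem_cons_of_mem μ hν)
    have hbox' : ∀ ν, (s'.1 ν - x₀ ν).val ≤ (x ν - x₀ ν).val := by
      intro ν
      rw [hs', taxiLegV_fst_apply]
      by_cases hν : ν = μ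
      · subst hν; rw [if_pos rfl]
      · rw [if_neg hν]; exact hbox ν
    have hA' : ‖(s'.2 : 𝔸) - 1‖ ≤ A + m * ρ := by
      rw [hs'2, Units.val_mul, hδ]
      calc _ ≤ ‖(s.2 : 𝔸) - 1‖ + ‖(parFwdV V μ (x μ - x₀ μ).val s.1 : 𝔸) - 1‖ := norm_mul_sub_one_le hs1
        _ ≤ A + (x μ - x₀ μ).val * ρ := add_le_add hA hF1
        _ ≤ A + m * ρ := by
            have : ((x μ - x₀ μ).val : ℝ) ≤ m := by exact_mod_cast hm μ
            nlinarith
    have hs1' : ‖(s'.2 : 𝔸)‖ ≤ 1 := by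
      rw [hs'2, Units.val_mul, hδ]
      calc _ ≤ ‖(s.2 : 𝔸)‖ * ‖(parFwdV V μ (x μ - x₀ μ).val s.1 : 𝔸)‖ := norm_mul_le _ _
        _ ≤ 1 * 1 := mul_le_mul hs1 hF2 (norm_nonneg _) zero_le_one
        _ = 1 := mul_one 1
    have hs2' : ‖((s'.2⁻¹ : 𝔸ˣ) : 𝔸)‖ ≤ 1 := by
      rw [hs'2, hδ, mul_inv_rev, Units.val_mul]
      calc _ ≤ ‖(((parFwdV V μ (x μ - x₀ μ).val s.1)⁻¹ : 𝔸ˣ) : 𝔸)‖ * ‖((s.2⁻¹ : 𝔸ˣ) : 𝔸)‖ := norm_mul_le _ _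
        _ ≤ 1 * 1 := mul_le_mul hF3 hs2 (norm_nonneg _) zero_le_one
        _ = 1 := mul_one 1
    have ih := taxiRun_near_one_of_box hρ hhalf hm hbond l s' (A + m * ρ) hnd' hstart' hbox' hA' hs1' hs2'
    simp only [taxiRun, List.foldl_cons] at ih ⊢
    rw [← hs']
    refine ⟨le_trans ih.1 (le_of_eq ?_), ih.2.1, ih.2.2⟩
    simp only [List.length_cons, Nat.cast_succ]
    ring

/-- ★★★ **THE TAXICAB CONTOUR VARIABLE TOWARDS A POINT AHEAD BY LESS THAN HALF A PERIOD**: if `2δ_μ ≤ N` and `δ_μ ≤ m` for every direction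
(`δ_μ = (x_μ − x₀,μ) mod N`), and every bond `⟨y, y + e_μ⟩` whose source lies in the box `{(y_ν − x₀,ν) mod N ≤ δ_ν ∀ν}` strictly behind `x` in
direction `μ` is `ρ`-close to `1` and a contraction pair, then `|U(Γ_{x₀,x}) − 1| ≤ d·m·ρ` and `U(Γ_{x₀,x})` is a contraction pair.
[cite: Balaban1985BackgroundPropagators, (3.19) p.393, (3.40) p.397, (3.35) p.396] -/
theorem parTaxiV_near_one_of_box {V : CfgV1 P 𝔸} {x₀ x : Site P 0} {ρ : ℝ} {m : ℕ} (hρ : 0 ≤ ρ)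
    (hhalf : ∀ μ, 2 * (x μ - x₀ μ).val ≤ P.sitesPerDir 0) (hm : ∀ μ, (x μ - x₀ μ).val ≤ m)
    (hbond : ∀ (μ : Fin P.d) (y : Site P 0), (∀ ν, (y ν - x₀ ν).val ≤ (x ν - x₀ ν).val) → (y μ - x₀ μ).val < (x μ - x₀ μ).val →
      ‖(V μ y : 𝔸) - 1‖ ≤ ρ ∧ ‖(V μ y : 𝔸)‖ ≤ 1 ∧ ‖(((V μ y)⁻¹ : 𝔸ˣ) : 𝔸)‖ ≤ 1) :
    ‖(parTaxiV V x₀ x : 𝔸) - 1‖ ≤ P.d * (m * ρ) ∧ ‖(parTaxiV V x₀ x : 𝔸)‖ ≤ 1 ∧ ‖(((parTaxiV V x₀ x)⁻¹ : 𝔸ˣ) : 𝔸)‖ ≤ 1 := by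
  have h := taxiRun_near_one_of_box h1 hρ hhalf hm hbond (List.finRange P.d) (x₀, 1) 0 (List.nodup_finRange P.d) (fun _ _ => rfl)
    (fun ν => by simp) (by simp) (by simpa using h1) (by simpa using h1)
  simp only [List.length_finRange, zero_add] at h
  exact h

end Box

end

end Literature.MathematicalPhysics.QuantumFieldTheory.Balaban1983to89.B9Thm31SiteCoerciveTaxiBlockY
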